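import Literature.Analysis.FluidPDE.NSFourierMild
import Mathlib.MeasureTheory.Integral.MeanInequalities
import Mathlib.MeasureTheory.Group.LIntegral
import Mathlib.Analysis.SpecialFunctions.Log.Base
import HarnessLib

/-!
# The Fourier-side Duhamel bilinear operator in `L¹`-type frequency norms

Support file for the discharge of the Bourgain–Pavlović barrier
`Literature.Barriers.NavierStokesRegularity.CriticalBesovNormInflation` (norm inflation for
Navier–Stokes in `Ḃ^{-1}_{∞,∞}`, Bourgain–Pavlović 2008, Thm. 1.1), which is carried out on the
tree's Fourier-side (pseudo-measure) formulation of the Navier–Stokes equations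
(`NSFourierBilinear`, `NSFourierPicard`, `NSFourierMild`: `V(t,ξ) = e^{-c‖ξ‖²t}a(ξ) − ∫₀ᵗ
e^{-c‖ξ‖²(t-r)} N(V(r),V(r))(ξ) dr`). Bourgain–Pavlović write the solution as
`u = e^{tΔ}u₀ − u₁ + y` with `u₁` the second Picard iterate and control the remainder `y` in
Koch–Tataru's path space (their §3); here the remainder will be controlled in `L¹_ξ`-based
norms, for which this file provides the basic calculus:

* `duhamelBilin c v w t ξ = ∫₀ᵗ e^{-c‖ξ‖²(t-r)} N(v(r), w(r))(ξ) dr`, the Duhamel bilinear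
  operator of the transformed system, so that a Fourier-side mild solution from time `0`
  satisfies `V(t) = e^{-c‖ξ‖²t} V(0) − duhamelBilin c V V t`
  (`IsFourierMild.eq_heat_smul_sub_duhamelBilin`);
* the pointwise convolution bound `‖N(v,w)(ξ)‖ ≤ 4π(card ι)² ‖ξ‖ (‖v‖ ⋆ ‖w‖)(ξ)`
  (`enorm_nonlin_le`) and the resulting bound on `duhamelBilin` (`enorm_duhamelBilin_le`);
* the `L¹` mass `massL1 Φ = ∫ ‖Φ(ξ)‖ dξ`, the weighted masses `xNeg Φ = ∫ ‖ξ‖⁻¹‖Φ(ξ)‖ dξ`,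
  `xPos Φ = ∫ ‖ξ‖ ‖Φ(ξ)‖ dξ` (the Fourier–Lebesgue forms of Lei–Lin's `𝒳^{-1}`, `𝒳^{1}` norms,
  Lei–Lin 2011, (1.3)), the interpolation inequality `massL1 Φ ² ≤ xNeg Φ · xPos Φ`
  (`massL1_sq_le`), and the mass identity `∫ (‖v‖ ⋆ ‖w‖) = massL1 v · massL1 w`;
* the two path functionals of a time-dependent coefficient field on `[0, T]`,
  `pathNormOne T Φ = ∫₀ᵀ xPos (Φ t) dt` and the dyadic-band Chemin–Lerner form of
  `L^∞_t 𝒳^{-1}`, `pathNormInf T Φ = ∑_{b ∈ ℤ} sup_{t ∈ [0,T]} ∫_{2^b ≤ ‖ξ‖ < 2^{b+1}} ‖ξ‖⁻¹‖Φ(t,ξ)‖ dξ`,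
  with the two **Duhamel estimates**
  `pathNormInf T (duhamelBilin c v w) ≤ C ∫₀ᵀ massL1(v r) massL1(w r) dr` and
  `pathNormOne T (duhamelBilin c v w) ≤ C c⁻¹ ∫₀ᵀ massL1(v r) massL1(w r) dr`
  (the second uses the heat gain `∫_r^T ‖ξ‖² e^{-c‖ξ‖²(t-r)} dt ≤ c⁻¹`; Lei–Lin 2011, proof of
  Thm. 1.1, estimates (2.3)–(2.5), in Fourier variables).

All quantities are `ℝ≥0∞`-valued Lebesgue integrals (no integrability side conditions);
coefficient fields are assumed jointly continuous in `(t, ξ)` where Tonelli is used.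

## References

* J. Bourgain, N. Pavlović, *Ill-posedness of the Navier–Stokes equations in a critical space in
  3D*, J. Funct. Anal. 255 (2008), §3. [BourgainPavlovic2008]
* Z. Lei, F. Lin, *Global mild solutions of Navier–Stokes equations*, Comm. Pure Appl. Math. 64
  (2011), 1297–1304, Thm. 1.1 and (1.3), (2.3)–(2.5). [LeiLin2011]
* P. G. Lemarié-Rieusset, *The Navier–Stokes problem in the 21st century*, CRC 2016, §8.5.
  [LemarieRieusset2016]
-/

noncomputable section

open MeasureTheory Real Set Filter Topology Function intervalIntegral
open scoped ENNReal NNReal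

namespace Literature.Analysis.FluidPDE.FourierNS

variable {ι : Type*} [Fintype ι]

/-! ### `ℝ≥0∞` bookkeeping on `ι → ℂ` -/

omit [Fintype ι] in
/-- A component is bounded by the sup norm, `ℝ≥0∞` form. [folklore] -/
theorem enorm_apply_le_enorm [Fintype ι] (x : ι → ℂ) (i : ι) : ‖x i‖ₑ ≤ ‖x‖ₑ := by
  rw [enorm_eq_nnnorm, enorm_eq_nnnorm, ENNReal.coe_le_coe]
  exact nnnorm_le_pi_nnnorm x i

/-- The sup norm is bounded by a common bound of the components, `ℝ≥0∞` form. [folklore] -/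
theorem pi_enorm_le_of_forall_le {x : ι → ℂ} {M : ℝ≥0∞} (h : ∀ i, ‖x i‖ₑ ≤ M) : ‖x‖ₑ ≤ M := by
  rcases eq_or_ne M ⊤ with rfl | hM
  · exact le_top
  · lift M to ℝ≥0 using hM
    rw [enorm_eq_nnnorm, ENNReal.coe_le_coe, pi_nnnorm_le_iff]
    intro i
    have := h i
    rwa [enorm_eq_nnnorm, ENNReal.coe_le_coe] at this

/-! ### The Duhamel bilinear operator -/

section Duhamel

variable [DecidableEq ι]

/-- **The Duhamel bilinear operator** of the Fourier-transformed Navier–Stokes system with heat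
rate `c`: `duhamelBilin c v w t ξ = ∫₀ᵗ e^{-c‖ξ‖²(t-r)} N(v(r), w(r))(ξ) dr` (interval integral;
for `t < 0` the orientation is reversed, irrelevant here). A mild solution from time `0` is
`V(t) = e^{-c‖ξ‖²t}V(0) − duhamelBilin c V V t` (Lemarié-Rieusset 2016, §8.5; the second Picard
iterate of Bourgain–Pavlović 2008, §3 is `duhamelBilin` of the free evolution with itself). [folklore] -/
def duhamelBilin (c : ℝ) (v w : ℝ → EuclideanSpace ℝ ι → ι → ℂ) (t : ℝ)
    (ξ : EuclideanSpace ℝ ι) : ι → ℂ :=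
  ∫ r in (0 : ℝ)..t, heat c ξ (t - r) • nonlin (v r) (w r) ξ

/-- Unfolding `duhamelBilin`. [folklore] -/
theorem duhamelBilin_apply (c : ℝ) (v w : ℝ → EuclideanSpace ℝ ι → ι → ℂ) (t : ℝ)
    (ξ : EuclideanSpace ℝ ι) :
    duhamelBilin c v w t ξ = ∫ r in (0 : ℝ)..t, heat c ξ (t - r) • nonlin (v r) (w r) ξ := rfl

/-- At `t = 0` the Duhamel term vanishes. [folklore] -/
@[simp]
theorem duhamelBilin_zero (c : ℝ) (v w : ℝ → EuclideanSpace ℝ ι → ι → ℂ)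
    (ξ : EuclideanSpace ℝ ι) : duhamelBilin c v w 0 ξ = 0 := by
  simp [duhamelBilin]

/-- At the zero frequency the Duhamel term vanishes (`N(v,w)(0) = 0`). [folklore] -/
@[simp]
theorem duhamelBilin_zero_freq (c : ℝ) (v w : ℝ → EuclideanSpace ℝ ι → ι → ℂ) (t : ℝ) :
    duhamelBilin c v w t 0 = 0 := by
  simp [duhamelBilin]

/-- **A Fourier-side mild solution from time `0` is the free evolution minus the Duhamel term**:
`V(t) = e^{-c‖ξ‖²t} V(0) − duhamelBilin c V V t` on `[0, T]` (the two-time Duhamel formula of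
`IsFourierMild` at `s = 0`; Lemarié-Rieusset 2016, §8.5). [folklore] -/
theorem IsFourierMild.eq_heat_smul_sub_duhamelBilin {c : ℝ} {K₀ : ℕ} {T : ℝ}
    {V : ℝ → EuclideanSpace ℝ ι → ι → ℂ} (h : IsFourierMild c K₀ 0 T V) {t : ℝ}
    (ht : t ∈ Icc 0 T) (ξ : EuclideanSpace ℝ ι) :
    V t ξ = heat c ξ t • V 0 ξ - duhamelBilin c V V t ξ := by
  have := h.duhamel le_rfl ht.1 ht.2 ξ
  simpa only [duhamelBilin, sub_zero] using this

end Duhamel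

/-! ### The convolution bound for the nonlinearity -/

section NonlinBound

variable [DecidableEq ι]

/-- The constant `4π (card ι)²` of the `L¹`-type nonlinear estimate. [folklore] -/
def nonlinMassConst (ι : Type*) [Fintype ι] : ℝ≥0∞ :=
  ENNReal.ofReal (4 * π * (Fintype.card ι : ℝ) ^ 2)

omit [DecidableEq ι] in
/-- `nonlinMassConst ι < ∞`. [folklore] -/
theorem nonlinMassConst_lt_top : nonlinMassConst ι < ⊤ := ENNReal.ofReal_lt_top

omit [DecidableEq ι] in
/-- **The convolution is bounded by the convolution of the moduli**, `ℝ≥0∞` form (no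
integrability needed): `‖(f ⋆ g)(ξ)‖ₑ ≤ ∫⁻ ‖f(η)‖ₑ ‖g(ξ-η)‖ₑ dη`. [folklore] -/
theorem enorm_fconv_le_lintegral_mul (f g : EuclideanSpace ℝ ι → ℂ) (ξ : EuclideanSpace ℝ ι) :
    ‖fconv f g ξ‖ₑ ≤ ∫⁻ η, ‖f η‖ₑ * ‖g (ξ - η)‖ₑ := by
  rw [fconv_apply]
  refine (enorm_integral_le_lintegral_enorm _).trans (le_of_eq ?_)
  simp_rw [enorm_mul]

omit [DecidableEq ι] in
/-- Componentwise convolutions are bounded by the convolution of the sup-norm moduli: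
`∫⁻ ‖v(η)_j‖ₑ ‖w(ξ-η)_k‖ₑ ≤ ∫⁻ ‖v(η)‖ₑ ‖w(ξ-η)‖ₑ`. [folklore] -/
theorem lintegral_enorm_apply_mul_le (v w : EuclideanSpace ℝ ι → ι → ℂ) (ξ : EuclideanSpace ℝ ι)
    (j k : ι) :
    ∫⁻ η, ‖v η j‖ₑ * ‖w (ξ - η) k‖ₑ ≤ ∫⁻ η, ‖v η‖ₑ * ‖w (ξ - η)‖ₑ :=
  lintegral_mono fun _ => mul_le_mul' (enorm_apply_le_enorm _ _) (enorm_apply_le_enorm _ _)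

/-- The symbol bound in `ℝ≥0∞` form: `‖m_{jkl}(ξ)‖ₑ ≤ 2‖ξ‖ₑ`. [folklore] -/
theorem enorm_ofReal_lerayDerivSymbol_le (j k l : ι) (ξ : EuclideanSpace ℝ ι) :
    ‖(lerayDerivSymbol j k l ξ : ℂ)‖ₑ ≤ 2 * ‖ξ‖ₑ :=
  calc ‖(lerayDerivSymbol j k l ξ : ℂ)‖ₑ = ENNReal.ofReal ‖(lerayDerivSymbol j k l ξ : ℂ)‖ :=
        (ofReal_norm _).symm
    _ ≤ ENNReal.ofReal (2 * ‖ξ‖) :=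
        ENNReal.ofReal_le_ofReal (norm_ofReal_lerayDerivSymbol_le j k l ξ)
    _ = 2 * ‖ξ‖ₑ := by
        rw [ENNReal.ofReal_mul zero_le_two, ENNReal.ofReal_ofNat, ofReal_norm]

/-- **The `L¹`-type nonlinear estimate, componentwise**:
`‖N(v,w)(ξ)_l‖ₑ ≤ 4π (card ι)² ‖ξ‖ₑ ∫⁻ ‖v(η)‖ₑ ‖w(ξ-η)‖ₑ dη`. [folklore] -/
theorem enorm_nonlin_apply_le_mass (v w : EuclideanSpace ℝ ι → ι → ℂ) (ξ : EuclideanSpace ℝ ι) (l : ι) :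
    ‖nonlin v w ξ l‖ₑ ≤ nonlinMassConst ι * ‖ξ‖ₑ * ∫⁻ η, ‖v η‖ₑ * ‖w (ξ - η)‖ₑ := by
  set X : ℝ≥0∞ := ∫⁻ η, ‖v η‖ₑ * ‖w (ξ - η)‖ₑ with hX
  have hterm : ∀ j k, ‖(lerayDerivSymbol j k l ξ : ℂ) * fconv (v · j) (w · k) ξ‖ₑ ≤
      2 * ‖ξ‖ₑ * X := fun j k => by
    rw [enorm_mul]
    exact mul_le_mul' (enorm_ofReal_lerayDerivSymbol_le j k l ξ)
      ((enorm_fconv_le_lintegral_mul _ _ ξ).trans (lintegral_enorm_apply_mul_le v w ξ j k))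
  have h2π : ‖-(2 * (π : ℂ) * Complex.I)‖ₑ = ENNReal.ofReal (2 * π) := by
    rw [← ofReal_norm]
    congr 1
    simp [Complex.norm_real, Real.norm_eq_abs, abs_of_pos Real.pi_pos]
  calc ‖nonlin v w ξ l‖ₑ
      = ‖-(2 * (π : ℂ) * Complex.I)‖ₑ *
          ‖∑ j, ∑ k, (lerayDerivSymbol j k l ξ : ℂ) * fconv (v · j) (w · k) ξ‖ₑ := by
        rw [nonlin_apply, enorm_mul]
    _ ≤ ENNReal.ofReal (2 * π) * ∑ j, ∑ k, (2 * ‖ξ‖ₑ * X) := by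
        rw [h2π]
        refine mul_le_mul' le_rfl ?_
        refine (enorm_sum_le _ _).trans (Finset.sum_le_sum fun j _ => ?_)
        exact (enorm_sum_le _ _).trans (Finset.sum_le_sum fun k _ => hterm j k)
    _ = nonlinMassConst ι * ‖ξ‖ₑ * X := by
        have hC : nonlinMassConst ι =
            ENNReal.ofReal (2 * π) * ((Fintype.card ι : ℝ≥0∞) * (Fintype.card ι : ℝ≥0∞) * 2) := by
          rw [nonlinMassConst, show (4 : ℝ) * π * (Fintype.card ι : ℝ) ^ 2 =
            (2 * π) * ((Fintype.card ι : ℝ) * (Fintype.card ι : ℝ) * 2) by ring,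
            ENNReal.ofReal_mul (by positivity)]
          congr 1
          rw [ENNReal.ofReal_mul (by positivity), ENNReal.ofReal_mul (by positivity),
            ENNReal.ofReal_natCast, ENNReal.ofReal_ofNat]
        simp only [Finset.sum_const, Finset.card_univ, nsmul_eq_mul]
        rw [hC]
        ring

/-- **The `L¹`-type nonlinear estimate**:
`‖N(v,w)(ξ)‖ₑ ≤ 4π (card ι)² ‖ξ‖ₑ (‖v‖ ⋆ ‖w‖)(ξ)` with the convolution of the moduli as a
Lebesgue integral (Lei–Lin 2011, proof of Thm. 1.1: `|ξ| |(û ⋆ û)(ξ)|`). [cite: LeiLin2011, proof of Thm. 1.1] -/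
theorem enorm_nonlin_le (v w : EuclideanSpace ℝ ι → ι → ℂ) (ξ : EuclideanSpace ℝ ι) :
    ‖nonlin v w ξ‖ₑ ≤ nonlinMassConst ι * ‖ξ‖ₑ * ∫⁻ η, ‖v η‖ₑ * ‖w (ξ - η)‖ₑ :=
  pi_enorm_le_of_forall_le fun l => enorm_nonlin_apply_le_mass v w ξ l

/-- **The Duhamel term is bounded by the time integral of the heat-damped nonlinearity**:
for `0 ≤ t`,
`‖duhamelBilin c v w t ξ‖ₑ ≤ ∫⁻_{r ∈ (0,t]} e^{-c‖ξ‖²(t-r)} ‖N(v(r),w(r))(ξ)‖ₑ dr`. [folklore] -/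
theorem enorm_duhamelBilin_le (c : ℝ) (v w : ℝ → EuclideanSpace ℝ ι → ι → ℂ) {t : ℝ} (ht : 0 ≤ t)
    (ξ : EuclideanSpace ℝ ι) :
    ‖duhamelBilin c v w t ξ‖ₑ ≤
      ∫⁻ r in Ioc 0 t, ENNReal.ofReal (heat c ξ (t - r)) * ‖nonlin (v r) (w r) ξ‖ₑ := by
  rw [duhamelBilin_apply, intervalIntegral.integral_of_le ht]
  refine (enorm_integral_le_lintegral_enorm _).trans (le_of_eq ?_)
  congr 1 with r
  rw [enorm_smul, Real.enorm_of_nonneg (heat_nonneg c ξ _)]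

/-- **The Duhamel term against the `L¹` convolution bound**: for `0 ≤ t` and `0 ≤ c`,
`‖duhamelBilin c v w t ξ‖ₑ ≤ C ‖ξ‖ₑ ∫⁻_{r ∈ (0,t]} ∫⁻ ‖v(r,η)‖ₑ‖w(r,ξ-η)‖ₑ dη dr`
(heat factor bounded by `1`). [folklore] -/
theorem enorm_duhamelBilin_le_mass {c : ℝ} (hc : 0 ≤ c) (v w : ℝ → EuclideanSpace ℝ ι → ι → ℂ)
    {t : ℝ} (ht : 0 ≤ t) (ξ : EuclideanSpace ℝ ι) :
    ‖duhamelBilin c v w t ξ‖ₑ ≤ nonlinMassConst ι * ‖ξ‖ₑ *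
      ∫⁻ r in Ioc 0 t, ∫⁻ η, ‖v r η‖ₑ * ‖w r (ξ - η)‖ₑ := by
  calc ‖duhamelBilin c v w t ξ‖ₑ
      ≤ ∫⁻ r in Ioc 0 t, ENNReal.ofReal (heat c ξ (t - r)) * ‖nonlin (v r) (w r) ξ‖ₑ :=
        enorm_duhamelBilin_le c v w ht ξ
    _ ≤ ∫⁻ r in Ioc 0 t, nonlinMassConst ι * ‖ξ‖ₑ * ∫⁻ η, ‖v r η‖ₑ * ‖w r (ξ - η)‖ₑ := by
        refine setLIntegral_mono' measurableSet_Ioc fun r hr => ?_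
        calc ENNReal.ofReal (heat c ξ (t - r)) * ‖nonlin (v r) (w r) ξ‖ₑ
            ≤ 1 * ‖nonlin (v r) (w r) ξ‖ₑ := by
              gcongr
              rw [← ENNReal.ofReal_one]
              exact ENNReal.ofReal_le_ofReal (heat_le_one hc (by linarith [hr.2]) ξ)
          _ ≤ _ := by rw [one_mul]; exact enorm_nonlin_le _ _ ξ
    _ = _ := by
        rw [lintegral_const_mul' _ _ (ENNReal.mul_ne_top nonlinMassConst_lt_top.ne enorm_ne_top)]

end NonlinBound

/-! ### `L¹` masses and the Lei–Lin weights -/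

section Mass

/-- The `L¹` mass `∫ ‖Φ(ξ)‖ dξ ∈ [0, ∞]` of a coefficient field (the Wiener-algebra norm of its
synthesis; Lei–Lin 2011, (1.3) with exponent `0`). [folklore] -/
def massL1 (Φ : EuclideanSpace ℝ ι → ι → ℂ) : ℝ≥0∞ := ∫⁻ ξ, ‖Φ ξ‖ₑ

/-- The Lei–Lin weight of order `-1`: `xNeg Φ = ∫ ‖ξ‖⁻¹ ‖Φ(ξ)‖ dξ ∈ [0, ∞]`, the Fourier–Lebesgue
form of the `𝒳^{-1}` norm (Lei–Lin 2011, (1.3)). [cite: LeiLin2011, (1.3)] -/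
def xNeg (Φ : EuclideanSpace ℝ ι → ι → ℂ) : ℝ≥0∞ := ∫⁻ ξ, ‖ξ‖ₑ⁻¹ * ‖Φ ξ‖ₑ

/-- The Lei–Lin weight of order `1`: `xPos Φ = ∫ ‖ξ‖ ‖Φ(ξ)‖ dξ ∈ [0, ∞]`, the Fourier–Lebesgue
form of the `𝒳^{1}` norm (Lei–Lin 2011, (1.3)). [cite: LeiLin2011, (1.3)] -/
def xPos (Φ : EuclideanSpace ℝ ι → ι → ℂ) : ℝ≥0∞ := ∫⁻ ξ, ‖ξ‖ₑ * ‖Φ ξ‖ₑ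

/-- Unfolding `massL1`. [folklore] -/
theorem massL1_eq (Φ : EuclideanSpace ℝ ι → ι → ℂ) : massL1 Φ = ∫⁻ ξ, ‖Φ ξ‖ₑ := rfl

/-- Unfolding `xNeg`. [folklore] -/
theorem xNeg_eq (Φ : EuclideanSpace ℝ ι → ι → ℂ) : xNeg Φ = ∫⁻ ξ, ‖ξ‖ₑ⁻¹ * ‖Φ ξ‖ₑ := rfl

/-- Unfolding `xPos`. [folklore] -/
theorem xPos_eq (Φ : EuclideanSpace ℝ ι → ι → ℂ) : xPos Φ = ∫⁻ ξ, ‖ξ‖ₑ * ‖Φ ξ‖ₑ := rfl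

/-- `massL1 0 = 0`. [folklore] -/
@[simp]
theorem massL1_zero : massL1 (0 : EuclideanSpace ℝ ι → ι → ℂ) = 0 := by simp [massL1]

/-- `xNeg 0 = 0`. [folklore] -/
@[simp]
theorem xNeg_zero : xNeg (0 : EuclideanSpace ℝ ι → ι → ℂ) = 0 := by simp [xNeg]

/-- `xPos 0 = 0`. [folklore] -/
@[simp]
theorem xPos_zero : xPos (0 : EuclideanSpace ℝ ι → ι → ℂ) = 0 := by simp [xPos]

/-- Monotonicity of the mass under pointwise domination. [folklore] -/
theorem massL1_mono {Φ Ψ : EuclideanSpace ℝ ι → ι → ℂ} (h : ∀ ξ, ‖Φ ξ‖ ≤ ‖Ψ ξ‖) :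
    massL1 Φ ≤ massL1 Ψ :=
  lintegral_mono fun ξ => by
    rw [← ofReal_norm, ← ofReal_norm]; exact ENNReal.ofReal_le_ofReal (h ξ)

/-- Subadditivity of the mass. [folklore] -/
theorem massL1_add_le (Φ Ψ : EuclideanSpace ℝ ι → ι → ℂ) (hΦ : AEStronglyMeasurable Φ volume) :
    massL1 (Φ + Ψ) ≤ massL1 Φ + massL1 Ψ := by
  calc massL1 (Φ + Ψ) ≤ ∫⁻ ξ, (‖Φ ξ‖ₑ + ‖Ψ ξ‖ₑ) := lintegral_mono fun ξ => enorm_add_le _ _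
    _ = massL1 Φ + massL1 Ψ := lintegral_add_left' hΦ.enorm _

/-- At a nonzero frequency the two Lei–Lin weights multiply to the square of the modulus:
`(‖ξ‖⁻¹‖Φ‖)(‖ξ‖ ‖Φ‖) = ‖Φ‖²`. [folklore] -/
theorem inv_mul_mul_mul_eq {ξ : EuclideanSpace ℝ ι} (hξ : ξ ≠ 0) (a : ℝ≥0∞) :
    ‖ξ‖ₑ⁻¹ * a * (‖ξ‖ₑ * a) = a * a := by
  have h0 : ‖ξ‖ₑ ≠ 0 := by rwa [ne_eq, enorm_eq_zero]
  calc ‖ξ‖ₑ⁻¹ * a * (‖ξ‖ₑ * a) = (‖ξ‖ₑ⁻¹ * ‖ξ‖ₑ) * (a * a) := by ring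
    _ = a * a := by rw [ENNReal.inv_mul_cancel h0 enorm_ne_top, one_mul]

variable [Nonempty ι]

/-- **Interpolation between the two Lei–Lin weights** (Cauchy–Schwarz;
Lei–Lin 2011, (2.4): `‖û‖_{L¹} ≤ ‖u‖^{1/2}_{𝒳^{-1}} ‖u‖^{1/2}_{𝒳^{1}}`):
`massL1 Φ ≤ (xNeg Φ)^{1/2} (xPos Φ)^{1/2}`. [cite: LeiLin2011, (2.4)] -/
theorem massL1_le_sqrt_mul_sqrt {Φ : EuclideanSpace ℝ ι → ι → ℂ} (hΦ : AEStronglyMeasurable Φ volume) :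
    massL1 Φ ≤ xNeg Φ ^ (1 / 2 : ℝ) * xPos Φ ^ (1 / 2 : ℝ) := by
  set f : EuclideanSpace ℝ ι → ℝ≥0∞ := fun ξ => (‖ξ‖ₑ⁻¹ * ‖Φ ξ‖ₑ) ^ (1 / 2 : ℝ) with hf
  set g : EuclideanSpace ℝ ι → ℝ≥0∞ := fun ξ => (‖ξ‖ₑ * ‖Φ ξ‖ₑ) ^ (1 / 2 : ℝ) with hg
  have hme : AEMeasurable (fun ξ : EuclideanSpace ℝ ι => ‖ξ‖ₑ) volume :=
    continuous_enorm.aemeasurable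
  have hfm : AEMeasurable f volume := (hme.inv.mul hΦ.enorm).pow_const _
  have hgm : AEMeasurable g volume := (hme.mul hΦ.enorm).pow_const _
  -- off the origin, `f g = ‖Φ‖`
  have hae : ∀ᵐ ξ ∂(volume : Measure (EuclideanSpace ℝ ι)), ‖Φ ξ‖ₑ = (f * g) ξ := by
    filter_upwards [Measure.ae_ne volume (0 : EuclideanSpace ℝ ι)] with ξ hξ
    simp only [hf, hg, Pi.mul_apply]
    rw [← ENNReal.mul_rpow_of_nonneg _ _ (by norm_num : (0 : ℝ) ≤ 1 / 2),
      inv_mul_mul_mul_eq hξ, ← pow_two, ← ENNReal.rpow_natCast, ← ENNReal.rpow_mul]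
    norm_num
  have hH := ENNReal.lintegral_mul_le_Lp_mul_Lq volume Real.HolderConjugate.two_two hfm hgm
  have h2 : ∀ ξ, f ξ ^ (2 : ℝ) = ‖ξ‖ₑ⁻¹ * ‖Φ ξ‖ₑ := fun ξ => by
    simp only [hf]; rw [← ENNReal.rpow_mul]; norm_num
  have h2' : ∀ ξ, g ξ ^ (2 : ℝ) = ‖ξ‖ₑ * ‖Φ ξ‖ₑ := fun ξ => by
    simp only [hg]; rw [← ENNReal.rpow_mul]; norm_num
  simp only [h2, h2'] at hH
  calc massL1 Φ = ∫⁻ ξ, (f * g) ξ := lintegral_congr_ae hae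
    _ ≤ _ := hH

/-- **Interpolation, squared form**: `massL1 Φ ² ≤ xNeg Φ · xPos Φ`. [cite: LeiLin2011, (2.4)] -/
theorem massL1_sq_le {Φ : EuclideanSpace ℝ ι → ι → ℂ} (hΦ : AEStronglyMeasurable Φ volume) :
    massL1 Φ ^ 2 ≤ xNeg Φ * xPos Φ := by
  have h := massL1_le_sqrt_mul_sqrt hΦ
  calc massL1 Φ ^ 2 ≤ (xNeg Φ ^ (1 / 2 : ℝ) * xPos Φ ^ (1 / 2 : ℝ)) ^ 2 := by gcongr
    _ = xNeg Φ * xPos Φ := by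
        rw [mul_pow, ← ENNReal.rpow_natCast, ← ENNReal.rpow_natCast, ← ENNReal.rpow_mul,
          ← ENNReal.rpow_mul]
        norm_num

end Mass

/-! ### Dyadic frequency bands -/

section Band

/-- The dyadic frequency band `{2^b ≤ ‖ξ‖ < 2^{b+1}}`, `b ∈ ℤ`. [folklore] -/
def band (ι : Type*) [Fintype ι] (b : ℤ) : Set (EuclideanSpace ℝ ι) :=
  {ξ | (2 : ℝ) ^ b ≤ ‖ξ‖ ∧ ‖ξ‖ < (2 : ℝ) ^ (b + 1)}

/-- Membership in a band. [folklore] -/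
theorem mem_band {b : ℤ} {ξ : EuclideanSpace ℝ ι} :
    ξ ∈ band ι b ↔ (2 : ℝ) ^ b ≤ ‖ξ‖ ∧ ‖ξ‖ < (2 : ℝ) ^ (b + 1) := Iff.rfl

/-- Bands are measurable. [folklore] -/
theorem measurableSet_band (b : ℤ) : MeasurableSet (band ι b) :=
  (measurableSet_le measurable_const continuous_norm.measurable).inter
    (measurableSet_lt continuous_norm.measurable measurable_const)

/-- Points of a band are nonzero. [folklore] -/
theorem ne_zero_of_mem_band {b : ℤ} {ξ : EuclideanSpace ℝ ι} (h : ξ ∈ band ι b) : ξ ≠ 0 := by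
  rintro rfl
  have := h.1
  rw [norm_zero] at this
  exact absurd this (not_le.2 (zpow_pos two_pos b))

/-- The norm on a band, from below: `2^b ≤ ‖ξ‖`. [folklore] -/
theorem zpow_le_norm_of_mem_band {b : ℤ} {ξ : EuclideanSpace ℝ ι} (h : ξ ∈ band ι b) :
    (2 : ℝ) ^ b ≤ ‖ξ‖ := h.1

/-- The norm on a band, from above: `‖ξ‖ < 2^{b+1}`. [folklore] -/
theorem norm_lt_zpow_of_mem_band {b : ℤ} {ξ : EuclideanSpace ℝ ι} (h : ξ ∈ band ι b) :
    ‖ξ‖ < (2 : ℝ) ^ (b + 1) := h.2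

/-- **The bands are pairwise disjoint.** [folklore] -/
theorem pairwise_disjoint_band : Pairwise (Disjoint on band ι) := by
  intro b b' hbb'
  rw [Function.onFun, Set.disjoint_left]
  intro ξ hξ hξ'
  rcases lt_or_gt_of_ne hbb' with h | h
  · have h1 : (2 : ℝ) ^ (b + 1) ≤ (2 : ℝ) ^ b' := zpow_le_zpow_right₀ one_le_two (by omega)
    linarith [hξ.2, hξ'.1]
  · have h1 : (2 : ℝ) ^ (b' + 1) ≤ (2 : ℝ) ^ b := zpow_le_zpow_right₀ one_le_two (by omega)
    linarith [hξ'.2, hξ.1]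

/-- **Every nonzero frequency lies in the band of index `⌊log₂ ‖ξ‖⌋`.** [folklore] -/
theorem mem_band_floor_logb {ξ : EuclideanSpace ℝ ι} (hξ : ξ ≠ 0) :
    ξ ∈ band ι ⌊Real.logb 2 ‖ξ‖⌋ := by
  have hpos : 0 < ‖ξ‖ := norm_pos_iff.2 hξ
  constructor
  · calc (2 : ℝ) ^ ⌊Real.logb 2 ‖ξ‖⌋ = (2 : ℝ) ^ ((⌊Real.logb 2 ‖ξ‖⌋ : ℤ) : ℝ) :=
          (Real.rpow_intCast _ _).symm
      _ ≤ (2 : ℝ) ^ Real.logb 2 ‖ξ‖ :=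
          Real.rpow_le_rpow_of_exponent_le one_le_two (Int.floor_le _)
      _ = ‖ξ‖ := Real.rpow_logb two_pos (by norm_num) hpos
  · calc ‖ξ‖ = (2 : ℝ) ^ Real.logb 2 ‖ξ‖ := (Real.rpow_logb two_pos (by norm_num) hpos).symm
      _ < (2 : ℝ) ^ (((⌊Real.logb 2 ‖ξ‖⌋ + 1 : ℤ)) : ℝ) := by
          refine Real.rpow_lt_rpow_of_exponent_lt one_lt_two ?_
          push_cast
          exact Int.lt_floor_add_one _
      _ = (2 : ℝ) ^ (⌊Real.logb 2 ‖ξ‖⌋ + 1) := Real.rpow_intCast _ _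

/-- **The bands cover the nonzero frequencies.** [folklore] -/
theorem iUnion_band : (⋃ b, band ι b) = {ξ | ξ ≠ 0} := by
  ext ξ
  simp only [mem_iUnion, mem_setOf_eq]
  exact ⟨fun ⟨b, hb⟩ => ne_zero_of_mem_band hb, fun h => ⟨_, mem_band_floor_logb h⟩⟩

/-- A set integral over one band is at most the whole integral. [folklore] -/
theorem setLIntegral_band_le (f : EuclideanSpace ℝ ι → ℝ≥0∞) (b : ℤ) :
    ∫⁻ ξ in band ι b, f ξ ≤ ∫⁻ ξ, f ξ :=
  setLIntegral_le_lintegral _ _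

/-- **Mass on a band from the weight of order `-1`**: `∫_{band b} ‖Φ‖ ≤ 2^{b+1} ∫_{band b} ‖ξ‖⁻¹‖Φ‖`. [folklore] -/
theorem setLIntegral_band_enorm_le_zpow_mul (Φ : EuclideanSpace ℝ ι → ι → ℂ) (b : ℤ) :
    ∫⁻ ξ in band ι b, ‖Φ ξ‖ₑ ≤
      ENNReal.ofReal ((2 : ℝ) ^ (b + 1)) * ∫⁻ ξ in band ι b, ‖ξ‖ₑ⁻¹ * ‖Φ ξ‖ₑ := by
  rw [← lintegral_const_mul' _ _ ENNReal.ofReal_ne_top]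
  refine setLIntegral_mono' (measurableSet_band b) fun ξ hξ => ?_
  have h0 : ‖ξ‖ₑ ≠ 0 := by rw [ne_eq, enorm_eq_zero]; exact ne_zero_of_mem_band hξ
  have hle : ‖ξ‖ₑ ≤ ENNReal.ofReal ((2 : ℝ) ^ (b + 1)) := by
    rw [← ofReal_norm]; exact ENNReal.ofReal_le_ofReal hξ.2.le
  calc ‖Φ ξ‖ₑ = ‖ξ‖ₑ * (‖ξ‖ₑ⁻¹ * ‖Φ ξ‖ₑ) := by
        rw [← mul_assoc, ENNReal.mul_inv_cancel h0 enorm_ne_top, one_mul]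
    _ ≤ ENNReal.ofReal ((2 : ℝ) ^ (b + 1)) * (‖ξ‖ₑ⁻¹ * ‖Φ ξ‖ₑ) := by gcongr

/-- **Mass on a band from the weight of order `1`**: `∫_{band b} ‖Φ‖ ≤ 2^{-b} ∫_{band b} ‖ξ‖ ‖Φ‖`. [folklore] -/
theorem setLIntegral_band_enorm_le_zpow_neg_mul (Φ : EuclideanSpace ℝ ι → ι → ℂ) (b : ℤ) :
    ∫⁻ ξ in band ι b, ‖Φ ξ‖ₑ ≤
      ENNReal.ofReal ((2 : ℝ) ^ (-b)) * ∫⁻ ξ in band ι b, ‖ξ‖ₑ * ‖Φ ξ‖ₑ := by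
  rw [← lintegral_const_mul' _ _ ENNReal.ofReal_ne_top]
  refine setLIntegral_mono' (measurableSet_band b) fun ξ hξ => ?_
  have hb : 0 < (2 : ℝ) ^ b := zpow_pos two_pos b
  -- `1 ≤ 2^{-b} ‖ξ‖` on the band
  have hle : (1 : ℝ≥0∞) ≤ ENNReal.ofReal ((2 : ℝ) ^ (-b)) * ‖ξ‖ₑ := by
    rw [← ofReal_norm, ← ENNReal.ofReal_mul (zpow_nonneg zero_le_two _), ← ENNReal.ofReal_one]
    refine ENNReal.ofReal_le_ofReal ?_
    rw [zpow_neg, inv_mul_eq_div, le_div_iff₀ hb, one_mul]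
    exact hξ.1
  calc ‖Φ ξ‖ₑ = 1 * ‖Φ ξ‖ₑ := (one_mul _).symm
    _ ≤ ENNReal.ofReal ((2 : ℝ) ^ (-b)) * ‖ξ‖ₑ * ‖Φ ξ‖ₑ := by gcongr
    _ = _ := by ring

variable [Nonempty ι]

/-- **Dyadic decomposition of a Lebesgue integral over frequency space**:
`∫⁻ f = ∑_b ∫⁻_{band b} f` (the origin is a null set). [folklore] -/
theorem lintegral_eq_tsum_band (f : EuclideanSpace ℝ ι → ℝ≥0∞) :
    ∫⁻ ξ, f ξ = ∑' b : ℤ, ∫⁻ ξ in band ι b, f ξ := by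
  rw [← lintegral_iUnion measurableSet_band pairwise_disjoint_band, iUnion_band,
    show ({ξ : EuclideanSpace ℝ ι | ξ ≠ 0}) = ({0} : Set (EuclideanSpace ℝ ι))ᶜ by
      ext ξ; simp, restrict_compl_singleton]

end Band

/-! ### The mass of a convolution of moduli -/

section ConvMass

/-- **The modulus convolution integrates to the product of the masses** (Tonelli and
translation invariance): `∫∫ ‖Φ(η)‖ ‖Ψ(ξ-η)‖ dη dξ = massL1 Φ · massL1 Ψ` for continuous
coefficient fields. [folklore] -/
theorem lintegral_lintegral_enorm_mul_enorm_sub {Φ Ψ : EuclideanSpace ℝ ι → ι → ℂ}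
    (hΦ : Continuous Φ) (hΨ : Continuous Ψ) :
    ∫⁻ ξ, ∫⁻ η, ‖Φ η‖ₑ * ‖Ψ (ξ - η)‖ₑ = massL1 Φ * massL1 Ψ := by
  have hmeas : Measurable (uncurry fun (ξ η : EuclideanSpace ℝ ι) => ‖Φ η‖ₑ * ‖Ψ (ξ - η)‖ₑ) := by
    change Measurable fun p : EuclideanSpace ℝ ι × EuclideanSpace ℝ ι => ‖Φ p.2‖ₑ * ‖Ψ (p.1 - p.2)‖ₑ
    fun_prop
  rw [lintegral_lintegral_swap hmeas.aemeasurable]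
  calc ∫⁻ η, ∫⁻ ξ, ‖Φ η‖ₑ * ‖Ψ (ξ - η)‖ₑ
      = ∫⁻ η, ‖Φ η‖ₑ * ∫⁻ ξ, ‖Ψ (ξ - η)‖ₑ := by
        congr 1 with η
        rw [lintegral_const_mul' _ _ enorm_ne_top]
    _ = ∫⁻ η, ‖Φ η‖ₑ * massL1 Ψ := by
        congr 1 with η
        rw [lintegral_sub_right_eq_self (fun ξ => ‖Ψ ξ‖ₑ) η, massL1]
    _ = massL1 Φ * massL1 Ψ := by
        rw [lintegral_mul_const'' _ hΦ.measurable.enorm.aemeasurable]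
        rfl

/-- The modulus convolution of the slices of jointly continuous time-dependent fields is jointly
measurable in `(r, ξ)`. [folklore] -/
theorem measurable_lintegral_enorm_mul_enorm_sub {v w : ℝ → EuclideanSpace ℝ ι → ι → ℂ}
    (hv : Continuous (uncurry v)) (hw : Continuous (uncurry w)) :
    Measurable fun p : ℝ × EuclideanSpace ℝ ι => ∫⁻ η, ‖v p.1 η‖ₑ * ‖w p.1 (p.2 - η)‖ₑ := by
  have h : Measurable fun q : (ℝ × EuclideanSpace ℝ ι) × EuclideanSpace ℝ ι =>
      ‖v q.1.1 q.2‖ₑ * ‖w q.1.1 (q.1.2 - q.2)‖ₑ := by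
    have h1 : Continuous fun q : (ℝ × EuclideanSpace ℝ ι) × EuclideanSpace ℝ ι => v q.1.1 q.2 :=
      hv.comp ((continuous_fst.comp continuous_fst).prodMk continuous_snd)
    have h2 : Continuous fun q : (ℝ × EuclideanSpace ℝ ι) × EuclideanSpace ℝ ι =>
        w q.1.1 (q.1.2 - q.2) :=
      hw.comp ((continuous_fst.comp continuous_fst).prodMk
        ((continuous_snd.comp continuous_fst).sub continuous_snd))
    exact h1.enorm.measurable.mul h2.enorm.measurable
  exact h.lintegral_prod_right'

end ConvMass

/-! ### The path functionals -/

section Path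

/-- **The band-wise `L^∞_t 𝒳^{-1}` functional** (Chemin–Lerner form): for a time-dependent
coefficient field `Φ` and a band index `b`,
`bandSup T Φ b = sup_{t ∈ [0,T]} ∫_{band b} ‖ξ‖⁻¹ ‖Φ(t,ξ)‖ dξ`. [folklore] -/
def bandSup (T : ℝ) (Φ : ℝ → EuclideanSpace ℝ ι → ι → ℂ) (b : ℤ) : ℝ≥0∞ :=
  ⨆ t ∈ Icc (0 : ℝ) T, ∫⁻ ξ in band ι b, ‖ξ‖ₑ⁻¹ * ‖Φ t ξ‖ₑ

/-- **The path functional of order `-1`**: `pathNormInf T Φ = ∑_{b ∈ ℤ} bandSup T Φ b`, the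
dyadic-band Chemin–Lerner form of `‖Φ‖_{L^∞([0,T]; 𝒳^{-1})}` (it dominates
`sup_t ‖Φ(t)‖_{𝒳^{-1}}`, `xNeg_le_pathNormInf`). [folklore] -/
def pathNormInf (T : ℝ) (Φ : ℝ → EuclideanSpace ℝ ι → ι → ℂ) : ℝ≥0∞ :=
  ∑' b : ℤ, bandSup T Φ b

/-- **The path functional of order `1`**: `pathNormOne T Φ = ∫₀ᵀ ‖Φ(t)‖_{𝒳^{1}} dt`
(Lei–Lin 2011, the dissipative half `∫₀ᵗ ‖u‖_{𝒳^{1}}` of Thm. 1.1). [cite: LeiLin2011, Thm. 1.1] -/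
def pathNormOne (T : ℝ) (Φ : ℝ → EuclideanSpace ℝ ι → ι → ℂ) : ℝ≥0∞ :=
  ∫⁻ t in Ioc (0 : ℝ) T, xPos (Φ t)

/-- **The path norm** `pathNorm T Φ = pathNormInf T Φ + pathNormOne T Φ`. [folklore] -/
def pathNorm (T : ℝ) (Φ : ℝ → EuclideanSpace ℝ ι → ι → ℂ) : ℝ≥0∞ :=
  pathNormInf T Φ + pathNormOne T Φ

variable {T : ℝ} {Φ : ℝ → EuclideanSpace ℝ ι → ι → ℂ}

/-- A slice's band integral is bounded by the band supremum. [folklore] -/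
theorem setLIntegral_band_le_bandSup {t : ℝ} (ht : t ∈ Icc 0 T) (b : ℤ) :
    ∫⁻ ξ in band ι b, ‖ξ‖ₑ⁻¹ * ‖Φ t ξ‖ₑ ≤ bandSup T Φ b :=
  le_iSup₂ (f := fun (t : ℝ) (_ : t ∈ Icc 0 T) => ∫⁻ ξ in band ι b, ‖ξ‖ₑ⁻¹ * ‖Φ t ξ‖ₑ) t ht

/-- `bandSup` is bounded by any uniform bound of the band integrals. [folklore] -/
theorem bandSup_le {b : ℤ} {M : ℝ≥0∞}
    (h : ∀ t ∈ Icc 0 T, ∫⁻ ξ in band ι b, ‖ξ‖ₑ⁻¹ * ‖Φ t ξ‖ₑ ≤ M) : bandSup T Φ b ≤ M :=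
  iSup₂_le h

/-- `pathNormInf ≤ pathNorm`. [folklore] -/
theorem pathNormInf_le_pathNorm : pathNormInf T Φ ≤ pathNorm T Φ := le_self_add

/-- `pathNormOne ≤ pathNorm`. [folklore] -/
theorem pathNormOne_le_pathNorm : pathNormOne T Φ ≤ pathNorm T Φ := le_add_self

variable [Nonempty ι]

/-- **The `𝒳^{-1}` weight of every slice is dominated by the path functional**:
`‖Φ(t)‖_{𝒳^{-1}} ≤ pathNormInf T Φ` for `t ∈ [0, T]`. [folklore] -/
theorem xNeg_le_pathNormInf {t : ℝ} (ht : t ∈ Icc 0 T) : xNeg (Φ t) ≤ pathNormInf T Φ := by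
  rw [xNeg, lintegral_eq_tsum_band]
  exact ENNReal.tsum_le_tsum fun b => setLIntegral_band_le_bandSup ht b

/-- `xNeg (Φ t) ≤ pathNorm T Φ` for `t ∈ [0, T]`. [folklore] -/
theorem xNeg_le_pathNorm {t : ℝ} (ht : t ∈ Icc 0 T) : xNeg (Φ t) ≤ pathNorm T Φ :=
  (xNeg_le_pathNormInf ht).trans pathNormInf_le_pathNorm

end Path

/-! ### The Duhamel estimate of order `-1` -/

section DuhamelInf

variable [DecidableEq ι] [Nonempty ι]

omit [Nonempty ι] in
/-- **The band-wise Duhamel estimate**: for `0 ≤ c`, `t ∈ [0, T]` and every band,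
`∫_{band b} ‖ξ‖⁻¹ ‖duhamelBilin c v w t ξ‖ ≤ C ∫_{band b} ∫₀ᵀ (‖v(r)‖ ⋆ ‖w(r)‖)(ξ) dr dξ`
(the factor `‖ξ‖` of the nonlinearity cancels the weight; heat factor `≤ 1`). [folklore] -/
theorem setLIntegral_band_duhamelBilin_le {c T : ℝ} (hc : 0 ≤ c)
    (v w : ℝ → EuclideanSpace ℝ ι → ι → ℂ) {t : ℝ} (ht : t ∈ Icc 0 T) (b : ℤ) :
    ∫⁻ ξ in band ι b, ‖ξ‖ₑ⁻¹ * ‖duhamelBilin c v w t ξ‖ₑ ≤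
      ∫⁻ ξ in band ι b, nonlinMassConst ι *
        ∫⁻ r in Ioc 0 T, ∫⁻ η, ‖v r η‖ₑ * ‖w r (ξ - η)‖ₑ := by
  refine setLIntegral_mono' (measurableSet_band b) fun ξ hξ => ?_
  have h0 : ‖ξ‖ₑ ≠ 0 := by rw [ne_eq, enorm_eq_zero]; exact ne_zero_of_mem_band hξ
  calc ‖ξ‖ₑ⁻¹ * ‖duhamelBilin c v w t ξ‖ₑ
      ≤ ‖ξ‖ₑ⁻¹ * (nonlinMassConst ι * ‖ξ‖ₑ *
          ∫⁻ r in Ioc 0 t, ∫⁻ η, ‖v r η‖ₑ * ‖w r (ξ - η)‖ₑ) := by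
        gcongr; exact enorm_duhamelBilin_le_mass hc v w ht.1 ξ
    _ = nonlinMassConst ι * ∫⁻ r in Ioc 0 t, ∫⁻ η, ‖v r η‖ₑ * ‖w r (ξ - η)‖ₑ := by
        calc ‖ξ‖ₑ⁻¹ * (nonlinMassConst ι * ‖ξ‖ₑ *
              ∫⁻ r in Ioc 0 t, ∫⁻ η, ‖v r η‖ₑ * ‖w r (ξ - η)‖ₑ)
            = (‖ξ‖ₑ⁻¹ * ‖ξ‖ₑ) * (nonlinMassConst ι *
                ∫⁻ r in Ioc 0 t, ∫⁻ η, ‖v r η‖ₑ * ‖w r (ξ - η)‖ₑ) := by ring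
          _ = _ := by rw [ENNReal.inv_mul_cancel h0 enorm_ne_top, one_mul]
    _ ≤ nonlinMassConst ι * ∫⁻ r in Ioc 0 T, ∫⁻ η, ‖v r η‖ₑ * ‖w r (ξ - η)‖ₑ := by
        gcongr
        exact ht.2

/-- **The Duhamel estimate of order `-1`** (Lei–Lin 2011, (2.3) in Fourier variables, in the
dyadic-band Chemin–Lerner form): for `0 ≤ c`, `0 ≤ T` and jointly continuous coefficient fields,
`pathNormInf T (duhamelBilin c v w) ≤ 4π(card ι)² ∫₀ᵀ massL1(v r) massL1(w r) dr`. The sup over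
`t` and the sum over bands are exchanged for free because the bound is monotone in `t`. [cite: LeiLin2011, (2.3)] -/
theorem pathNormInf_duhamelBilin_le {c T : ℝ} (hc : 0 ≤ c) {v w : ℝ → EuclideanSpace ℝ ι → ι → ℂ}
    (hv : Continuous (uncurry v)) (hw : Continuous (uncurry w)) :
    pathNormInf T (duhamelBilin c v w) ≤
      nonlinMassConst ι * ∫⁻ r in Ioc 0 T, massL1 (v r) * massL1 (w r) := by
  set H : ℝ → EuclideanSpace ℝ ι → ℝ≥0∞ := fun r ξ => ∫⁻ η, ‖v r η‖ₑ * ‖w r (ξ - η)‖ₑ with hH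
  have hHm : Measurable (uncurry fun (ξ : EuclideanSpace ℝ ι) (r : ℝ) => H r ξ) := by
    change Measurable ((fun p : ℝ × EuclideanSpace ℝ ι => H p.1 p.2) ∘ Prod.swap)
    exact (measurable_lintegral_enorm_mul_enorm_sub hv hw).comp measurable_swap
  calc pathNormInf T (duhamelBilin c v w)
      ≤ ∑' b : ℤ, ∫⁻ ξ in band ι b, nonlinMassConst ι * ∫⁻ r in Ioc 0 T, H r ξ :=
        ENNReal.tsum_le_tsum fun b => bandSup_le fun t ht =>
          setLIntegral_band_duhamelBilin_le hc v w ht b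
    _ = ∫⁻ ξ, nonlinMassConst ι * ∫⁻ r in Ioc 0 T, H r ξ := (lintegral_eq_tsum_band _).symm
    _ = nonlinMassConst ι * ∫⁻ r in Ioc 0 T, ∫⁻ ξ, H r ξ := by
        rw [lintegral_const_mul' _ _ nonlinMassConst_lt_top.ne,
          lintegral_lintegral_swap hHm.aemeasurable]
    _ = nonlinMassConst ι * ∫⁻ r in Ioc 0 T, massL1 (v r) * massL1 (w r) := by
        congr 1
        refine lintegral_congr fun r => ?_
        exact lintegral_lintegral_enorm_mul_enorm_sub (hv.uncurry_left r) (hw.uncurry_left r)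

/-- **The Duhamel estimate of order `-1` for the path norm.** [cite: LeiLin2011, (2.3)] -/
theorem pathNormInf_duhamelBilin_le_of_le {c T : ℝ} (hc : 0 ≤ c)
    {v w : ℝ → EuclideanSpace ℝ ι → ι → ℂ} (hv : Continuous (uncurry v))
    (hw : Continuous (uncurry w)) {B : ℝ≥0∞}
    (hB : ∫⁻ r in Ioc 0 T, massL1 (v r) * massL1 (w r) ≤ B) :
    pathNormInf T (duhamelBilin c v w) ≤ nonlinMassConst ι * B :=
  (pathNormInf_duhamelBilin_le hc hv hw).trans (mul_le_mul' le_rfl hB)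

end DuhamelInf

/-! ### The heat gain and the Duhamel estimate of order `1` -/

section HeatGain

/-- The time-ordered, twice-weighted heat kernel `k(t, r, ξ) = 1_{r ≤ t} ‖ξ‖² e^{-c‖ξ‖²(t-r)}`
as an `ℝ≥0∞`-valued function (the kernel through which `duhamelBilin` loses the weight of
`𝒳^{1}` and the factor `‖ξ‖` of the nonlinearity). [folklore] -/
def heatGainKernel (c t r : ℝ) (ξ : EuclideanSpace ℝ ι) : ℝ≥0∞ :=
  if r ≤ t then ENNReal.ofReal (‖ξ‖ ^ 2 * heat c ξ (t - r)) else 0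

omit [Fintype ι] in
/-- The kernel vanishes before the source time. [folklore] -/
theorem heatGainKernel_of_lt [Fintype ι] {c t r : ℝ} (h : t < r) (ξ : EuclideanSpace ℝ ι) :
    heatGainKernel c t r ξ = 0 := by
  simp [heatGainKernel, not_le.2 h]

omit [Fintype ι] in
/-- The kernel after the source time. [folklore] -/
theorem heatGainKernel_of_le [Fintype ι] {c t r : ℝ} (h : r ≤ t) (ξ : EuclideanSpace ℝ ι) :
    heatGainKernel c t r ξ = ENNReal.ofReal (‖ξ‖ ^ 2 * heat c ξ (t - r)) := by
  simp [heatGainKernel, h]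

/-- The kernel is jointly measurable in `(t, ξ, r)`. [folklore] -/
theorem measurable_heatGainKernel (c : ℝ) :
    Measurable fun p : ℝ × EuclideanSpace ℝ ι × ℝ => heatGainKernel c p.1 p.2.2 p.2.1 := by
  unfold heatGainKernel
  refine Measurable.ite ?_ ?_ measurable_const
  · exact measurableSet_le (measurable_snd.comp measurable_snd) measurable_fst
  · refine ENNReal.measurable_ofReal.comp ?_
    have h1 : Continuous fun p : ℝ × EuclideanSpace ℝ ι × ℝ => ‖p.2.1‖ ^ 2 := by fun_prop
    have h2 : Continuous fun p : ℝ × EuclideanSpace ℝ ι × ℝ => heat c p.2.1 (p.1 - p.2.2) :=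
      continuous_heat_comp c (by fun_prop) (by fun_prop)
    exact (h1.mul h2).measurable

/-- The kernel is dominated by the untruncated weighted heat factor after the source time:
`k(t, r, ξ) ≤ 1_{[r, ∞)}(t) ‖ξ‖² e^{-c‖ξ‖²(t-r)}`. [folklore] -/
theorem heatGainKernel_le_indicator (c t r : ℝ) (ξ : EuclideanSpace ℝ ι) :
    heatGainKernel c t r ξ ≤
      (Ici r).indicator (fun t => ENNReal.ofReal (‖ξ‖ ^ 2 * heat c ξ (t - r))) t := by
  by_cases h : r ≤ t
  · rw [heatGainKernel_of_le h, indicator_of_mem (mem_Ici.2 h)]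
  · rw [heatGainKernel_of_lt (not_le.1 h)]
    exact bot_le

/-- **The heat gain**: `∫_r^S ‖ξ‖² e^{-c‖ξ‖²(t-r)} dt = c⁻¹ (1 - e^{-c‖ξ‖²(S-r)}) ≤ c⁻¹` for `c > 0`
(fundamental theorem of calculus; the factor `‖ξ‖²` is exactly absorbed). [folklore] -/
theorem integral_norm_sq_mul_heat_le {c : ℝ} (hc : 0 < c) (ξ : EuclideanSpace ℝ ι) (r S : ℝ) :
    ∫ t in r..S, ‖ξ‖ ^ 2 * heat c ξ (t - r) ≤ c⁻¹ := by
  set a : ℝ := c * ‖ξ‖ ^ 2 with ha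
  -- antiderivative `F(t) = -c⁻¹ e^{-a (t - r)}`
  have hderiv : ∀ t, HasDerivAt (fun t => -c⁻¹ * Real.exp (-a * (t - r)))
      (‖ξ‖ ^ 2 * heat c ξ (t - r)) t := by
    intro t
    have h1 : HasDerivAt (fun t => -a * (t - r)) (-a * 1) t :=
      ((hasDerivAt_id t).sub_const r).const_mul (-a)
    have h2 := h1.exp.const_mul (-c⁻¹)
    refine h2.congr_deriv ?_
    rw [show heat c ξ (t - r) = Real.exp (-(c * ‖ξ‖ ^ 2) * (t - r)) from rfl, ha, neg_mul]
    field_simp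
  have hcont : Continuous fun t => ‖ξ‖ ^ 2 * heat c ξ (t - r) :=
    continuous_const.mul (continuous_heat_comp c continuous_const (continuous_id.sub continuous_const))
  rw [intervalIntegral.integral_eq_sub_of_hasDerivAt (fun t _ => hderiv t)
    (hcont.intervalIntegrable _ _)]
  simp only [sub_self, mul_zero, Real.exp_zero, mul_one]
  have hexp : 0 < Real.exp (-a * (S - r)) := Real.exp_pos _
  have hci : 0 < c⁻¹ := inv_pos.2 hc
  nlinarith [mul_pos hci hexp]

/-- **The heat gain in `ℝ≥0∞` form**: `∫⁻_{t ∈ (0,T]} k(t, r, ξ) dt ≤ c⁻¹` for `c > 0`, every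
source time `r` and every frequency. [folklore] -/
theorem lintegral_heatGainKernel_le {c : ℝ} (hc : 0 < c) (T r : ℝ) (ξ : EuclideanSpace ℝ ι) :
    ∫⁻ t in Ioc 0 T, heatGainKernel c t r ξ ≤ ENNReal.ofReal c⁻¹ := by
  set G : ℝ → ℝ := fun t => ‖ξ‖ ^ 2 * heat c ξ (t - r) with hG
  have hG0 : ∀ t, 0 ≤ G t := fun t => mul_nonneg (sq_nonneg _) (heat_nonneg c ξ _)
  have hcont : Continuous G :=
    continuous_const.mul (continuous_heat_comp c continuous_const (continuous_id.sub continuous_const))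
  set S : ℝ := max r T with hS
  have hrS : r ≤ S := le_max_left _ _
  calc ∫⁻ t in Ioc 0 T, heatGainKernel c t r ξ
      ≤ ∫⁻ t in Ioc 0 T, (Ici r).indicator (fun t => ENNReal.ofReal (G t)) t :=
        lintegral_mono fun t => heatGainKernel_le_indicator c t r ξ
    _ = ∫⁻ t in Ioc 0 T ∩ Ici r, ENNReal.ofReal (G t) := by
        rw [lintegral_indicator measurableSet_Ici, Measure.restrict_restrict measurableSet_Ici,
          inter_comm]
    _ ≤ ∫⁻ t in Icc r S, ENNReal.ofReal (G t) := by
        refine lintegral_mono_set fun t ht => ⟨ht.2, ht.1.2.trans (le_max_right _ _)⟩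
    _ = ENNReal.ofReal (∫ t in Icc r S, G t) := by
        rw [ofReal_integral_eq_lintegral_ofReal (hcont.integrableOn_Icc)
          (Eventually.of_forall hG0)]
    _ = ENNReal.ofReal (∫ t in r..S, G t) := by
        rw [intervalIntegral.integral_of_le hrS, integral_Icc_eq_integral_Ioc]
    _ ≤ ENNReal.ofReal c⁻¹ := ENNReal.ofReal_le_ofReal (integral_norm_sq_mul_heat_le hc ξ r S)

end HeatGain

section DuhamelOne

variable [DecidableEq ι] [Nonempty ι]

omit [Nonempty ι] in
/-- **Pointwise form of the order-`1` Duhamel bound**: for `0 < t ≤ T`,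
`‖ξ‖ ‖duhamelBilin c v w t ξ‖ ≤ C ∫⁻_{r ∈ (0,T]} k(t,r,ξ) (‖v(r)‖ ⋆ ‖w(r)‖)(ξ) dr`. [folklore] -/
theorem enorm_mul_enorm_duhamelBilin_le {c T : ℝ} (v w : ℝ → EuclideanSpace ℝ ι → ι → ℂ) {t : ℝ}
    (ht : t ∈ Ioc 0 T) (ξ : EuclideanSpace ℝ ι) :
    ‖ξ‖ₑ * ‖duhamelBilin c v w t ξ‖ₑ ≤ nonlinMassConst ι *
      ∫⁻ r in Ioc 0 T, heatGainKernel c t r ξ * ∫⁻ η, ‖v r η‖ₑ * ‖w r (ξ - η)‖ₑ := by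
  set H : ℝ → ℝ≥0∞ := fun r => ∫⁻ η, ‖v r η‖ₑ * ‖w r (ξ - η)‖ₑ with hH
  have hsq : ‖ξ‖ₑ * ‖ξ‖ₑ = ENNReal.ofReal (‖ξ‖ ^ 2) := by
    rw [← ofReal_norm, ← ENNReal.ofReal_mul (norm_nonneg _), sq]
  calc ‖ξ‖ₑ * ‖duhamelBilin c v w t ξ‖ₑ
      ≤ ‖ξ‖ₑ * ∫⁻ r in Ioc 0 t, ENNReal.ofReal (heat c ξ (t - r)) * ‖nonlin (v r) (w r) ξ‖ₑ := by
        gcongr; exact enorm_duhamelBilin_le c v w ht.1.le ξ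
    _ ≤ ‖ξ‖ₑ * ∫⁻ r in Ioc 0 t, ENNReal.ofReal (heat c ξ (t - r)) *
          (nonlinMassConst ι * ‖ξ‖ₑ * H r) := by
        gcongr with r; exact enorm_nonlin_le _ _ ξ
    _ = nonlinMassConst ι * ∫⁻ r in Ioc 0 t, ENNReal.ofReal (‖ξ‖ ^ 2 * heat c ξ (t - r)) * H r := by
        rw [← lintegral_const_mul' _ _ enorm_ne_top,
          ← lintegral_const_mul' _ _ nonlinMassConst_lt_top.ne]
        refine lintegral_congr fun r => ?_
        rw [ENNReal.ofReal_mul (sq_nonneg _), ← hsq]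
        ring
    _ = nonlinMassConst ι * ∫⁻ r in Ioc 0 T, heatGainKernel c t r ξ * H r := by
        congr 1
        have hset : Ioc 0 t = Ioc 0 T ∩ Iic t := by
          rw [Ioc_inter_Iic, min_eq_right ht.2]
        rw [hset, inter_comm, ← Measure.restrict_restrict measurableSet_Iic,
          ← lintegral_indicator measurableSet_Iic]
        refine lintegral_congr fun r => ?_
        by_cases hr : r ≤ t
        · rw [indicator_of_mem (mem_Iic.2 hr), heatGainKernel_of_le hr]
        · rw [indicator_of_notMem (fun h => hr (mem_Iic.1 h)), heatGainKernel_of_lt (not_le.1 hr),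
            zero_mul]

omit [DecidableEq ι] [Nonempty ι] in
/-- Measurability of the kernel along measurable reparametrisations. [folklore] -/
theorem measurable_heatGainKernel_comp {α : Type*} [MeasurableSpace α] (c : ℝ) {ft fr : α → ℝ}
    {fξ : α → EuclideanSpace ℝ ι} (hft : Measurable ft) (hfr : Measurable fr)
    (hfξ : Measurable fξ) : Measurable fun a => heatGainKernel c (ft a) (fr a) (fξ a) :=
  (measurable_heatGainKernel c).comp (hft.prodMk (hfξ.prodMk hfr))

omit [DecidableEq ι] [Nonempty ι] in
/-- **The kernel integrates out** (Tonelli twice and the heat gain): for `c > 0` and a jointly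
measurable nonnegative `H(r, ξ)`,
`∫₀ᵀ ∫ ∫₀ᵀ k(t,r,ξ) H(r,ξ) dr dξ dt ≤ c⁻¹ ∫₀ᵀ ∫ H(r,ξ) dξ dr`. [folklore] -/
theorem lintegral_heatGainKernel_mul_le {c : ℝ} (hc : 0 < c) (T : ℝ)
    {H : ℝ → EuclideanSpace ℝ ι → ℝ≥0∞} (hHm : Measurable fun p : ℝ × EuclideanSpace ℝ ι => H p.1 p.2) :
    ∫⁻ t in Ioc 0 T, ∫⁻ ξ, ∫⁻ r in Ioc 0 T, heatGainKernel c t r ξ * H r ξ ≤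
      ENNReal.ofReal c⁻¹ * ∫⁻ r in Ioc 0 T, ∫⁻ ξ, H r ξ := by
  let μT : Measure ℝ := volume.restrict (Ioc 0 T)
  have hKH : Measurable fun q : (ℝ × EuclideanSpace ℝ ι) × ℝ =>
      heatGainKernel c q.1.1 q.2 q.1.2 * H q.2 q.1.2 :=
    (measurable_heatGainKernel_comp c measurable_fst.fst measurable_snd measurable_fst.snd).mul
      (hHm.comp (measurable_snd.prodMk measurable_fst.snd))
  -- exchange `t` and `ξ`
  have h2 : ∫⁻ t in Ioc 0 T, ∫⁻ ξ, ∫⁻ r in Ioc 0 T, heatGainKernel c t r ξ * H r ξ =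
      ∫⁻ ξ, ∫⁻ t in Ioc 0 T, ∫⁻ r in Ioc 0 T, heatGainKernel c t r ξ * H r ξ :=
    lintegral_lintegral_swap (μ := μT) (ν := volume)
      (hKH.lintegral_prod_right' (ν := μT)).aemeasurable
  -- exchange `t` and `r`, and integrate the kernel in `t`
  have h3 : ∀ ξ, ∫⁻ t in Ioc 0 T, ∫⁻ r in Ioc 0 T, heatGainKernel c t r ξ * H r ξ ≤
      ∫⁻ r in Ioc 0 T, H r ξ * ENNReal.ofReal c⁻¹ := by
    intro ξ
    have hm : AEMeasurable (uncurry fun t r => heatGainKernel c t r ξ * H r ξ) (μT.prod μT) :=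
      (hKH.comp ((measurable_fst.prodMk measurable_const).prodMk measurable_snd)).aemeasurable
    rw [lintegral_lintegral_swap (μ := μT) (ν := μT) hm]
    refine lintegral_mono fun r => ?_
    have hkm : AEMeasurable (fun t => heatGainKernel c t r ξ) μT :=
      (measurable_heatGainKernel_comp c measurable_id measurable_const measurable_const).aemeasurable
    calc ∫⁻ t in Ioc 0 T, heatGainKernel c t r ξ * H r ξ
        = (∫⁻ t in Ioc 0 T, heatGainKernel c t r ξ) * H r ξ := lintegral_mul_const'' _ hkm
      _ ≤ ENNReal.ofReal c⁻¹ * H r ξ := by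
          gcongr; exact lintegral_heatGainKernel_le hc T r ξ
      _ = H r ξ * ENNReal.ofReal c⁻¹ := mul_comm _ _
  -- exchange `ξ` and `r` back
  have h4 : ∫⁻ ξ, ∫⁻ r in Ioc 0 T, H r ξ * ENNReal.ofReal c⁻¹ =
      ENNReal.ofReal c⁻¹ * ∫⁻ r in Ioc 0 T, ∫⁻ ξ, H r ξ := by
    have hm : AEMeasurable (uncurry fun (ξ : EuclideanSpace ℝ ι) (r : ℝ) => H r ξ * ENNReal.ofReal c⁻¹)
        (volume.prod μT) :=
      ((hHm.comp (measurable_snd.prodMk measurable_fst)).mul_const _).aemeasurable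
    rw [lintegral_lintegral_swap (μ := volume) (ν := μT) hm]
    calc ∫⁻ r in Ioc 0 T, ∫⁻ ξ, H r ξ * ENNReal.ofReal c⁻¹
        = ∫⁻ r in Ioc 0 T, (∫⁻ ξ, H r ξ) * ENNReal.ofReal c⁻¹ := by
          refine lintegral_congr fun r => ?_
          rw [lintegral_mul_const' _ _ ENNReal.ofReal_ne_top]
      _ = (∫⁻ r in Ioc 0 T, ∫⁻ ξ, H r ξ) * ENNReal.ofReal c⁻¹ := by
          rw [lintegral_mul_const' _ _ ENNReal.ofReal_ne_top]
      _ = ENNReal.ofReal c⁻¹ * ∫⁻ r in Ioc 0 T, ∫⁻ ξ, H r ξ := mul_comm _ _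
  calc ∫⁻ t in Ioc 0 T, ∫⁻ ξ, ∫⁻ r in Ioc 0 T, heatGainKernel c t r ξ * H r ξ
      = ∫⁻ ξ, ∫⁻ t in Ioc 0 T, ∫⁻ r in Ioc 0 T, heatGainKernel c t r ξ * H r ξ := h2
    _ ≤ ∫⁻ ξ, ∫⁻ r in Ioc 0 T, H r ξ * ENNReal.ofReal c⁻¹ := lintegral_mono h3
    _ = ENNReal.ofReal c⁻¹ * ∫⁻ r in Ioc 0 T, ∫⁻ ξ, H r ξ := h4

omit [Nonempty ι] in
/-- **The Duhamel estimate of order `1`** (Lei–Lin 2011, (2.5) in Fourier variables): for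
`c > 0` and jointly continuous coefficient fields,
`pathNormOne T (duhamelBilin c v w) ≤ 4π(card ι)² c⁻¹ ∫₀ᵀ massL1(v r) massL1(w r) dr` — the time
integral of the weighted heat factor `∫_r^T ‖ξ‖² e^{-c‖ξ‖²(t-r)} dt ≤ c⁻¹` absorbs both the weight
of `𝒳^{1}` and the derivative in the nonlinearity. [cite: LeiLin2011, (2.5)] -/
theorem pathNormOne_duhamelBilin_le {c T : ℝ} (hc : 0 < c) {v w : ℝ → EuclideanSpace ℝ ι → ι → ℂ}
    (hv : Continuous (uncurry v)) (hw : Continuous (uncurry w)) :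
    pathNormOne T (duhamelBilin c v w) ≤
      nonlinMassConst ι * ENNReal.ofReal c⁻¹ * ∫⁻ r in Ioc 0 T, massL1 (v r) * massL1 (w r) := by
  have hHm := measurable_lintegral_enorm_mul_enorm_sub hv hw
  -- Step 1: the pointwise bound, integrated
  have h1 : pathNormOne T (duhamelBilin c v w) ≤
      nonlinMassConst ι * ∫⁻ t in Ioc 0 T, ∫⁻ ξ, ∫⁻ r in Ioc 0 T, heatGainKernel c t r ξ *
        ∫⁻ η, ‖v r η‖ₑ * ‖w r (ξ - η)‖ₑ := by
    calc pathNormOne T (duhamelBilin c v w)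
        ≤ ∫⁻ t in Ioc 0 T, ∫⁻ ξ, nonlinMassConst ι *
            ∫⁻ r in Ioc 0 T, heatGainKernel c t r ξ * ∫⁻ η, ‖v r η‖ₑ * ‖w r (ξ - η)‖ₑ :=
          setLIntegral_mono' measurableSet_Ioc fun t ht =>
            lintegral_mono fun ξ => enorm_mul_enorm_duhamelBilin_le v w ht ξ
      _ = _ := by
          rw [← lintegral_const_mul' _ _ nonlinMassConst_lt_top.ne]
          refine lintegral_congr fun t => ?_
          rw [lintegral_const_mul' _ _ nonlinMassConst_lt_top.ne]
  -- Step 2: the kernel integrates out (abstract Tonelli lemma)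
  have h2 := lintegral_heatGainKernel_mul_le hc T
    (H := fun r ξ => ∫⁻ η, ‖v r η‖ₑ * ‖w r (ξ - η)‖ₑ) hHm
  -- Step 3: identify the masses
  have h3 : ∫⁻ r in Ioc 0 T, ∫⁻ ξ, ∫⁻ η, ‖v r η‖ₑ * ‖w r (ξ - η)‖ₑ =
      ∫⁻ r in Ioc 0 T, massL1 (v r) * massL1 (w r) :=
    lintegral_congr fun r =>
      lintegral_lintegral_enorm_mul_enorm_sub (hv.uncurry_left r) (hw.uncurry_left r)
  calc pathNormOne T (duhamelBilin c v w)
      ≤ nonlinMassConst ι * ∫⁻ t in Ioc 0 T, ∫⁻ ξ, ∫⁻ r in Ioc 0 T, heatGainKernel c t r ξ *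
          ∫⁻ η, ‖v r η‖ₑ * ‖w r (ξ - η)‖ₑ := h1
    _ ≤ nonlinMassConst ι * (ENNReal.ofReal c⁻¹ *
          ∫⁻ r in Ioc 0 T, ∫⁻ ξ, ∫⁻ η, ‖v r η‖ₑ * ‖w r (ξ - η)‖ₑ) := mul_le_mul' le_rfl h2
    _ = nonlinMassConst ι * ENNReal.ofReal c⁻¹ * ∫⁻ r in Ioc 0 T, massL1 (v r) * massL1 (w r) := by
        rw [h3, mul_assoc]

/-- **The Duhamel estimate for the path norm** (sum of the two estimates): for `c > 0` and
jointly continuous coefficient fields,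
`pathNorm T (duhamelBilin c v w) ≤ 4π(card ι)² (1 + c⁻¹) ∫₀ᵀ massL1(v r) massL1(w r) dr`
(Lei–Lin 2011, proof of Thm. 1.1, (2.3)–(2.5), in Fourier variables and Chemin–Lerner form). [cite: LeiLin2011, (2.3)–(2.5)] -/
theorem pathNorm_duhamelBilin_le {c T : ℝ} (hc : 0 < c) {v w : ℝ → EuclideanSpace ℝ ι → ι → ℂ}
    (hv : Continuous (uncurry v)) (hw : Continuous (uncurry w)) :
    pathNorm T (duhamelBilin c v w) ≤
      nonlinMassConst ι * (1 + ENNReal.ofReal c⁻¹) * ∫⁻ r in Ioc 0 T, massL1 (v r) * massL1 (w r) := by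
  have h1 := pathNormInf_duhamelBilin_le (T := T) hc.le hv hw
  have h2 := pathNormOne_duhamelBilin_le (T := T) hc hv hw
  calc pathNorm T (duhamelBilin c v w)
      ≤ (nonlinMassConst ι * ∫⁻ r in Ioc 0 T, massL1 (v r) * massL1 (w r)) +
          nonlinMassConst ι * ENNReal.ofReal c⁻¹ * ∫⁻ r in Ioc 0 T, massL1 (v r) * massL1 (w r) :=
        add_le_add h1 h2
    _ = _ := by ring

end DuhamelOne

/-! ### Consequences: the quadratic, the lacunary-linear and the low-frequency-linear bounds -/

section Consequences

variable [Nonempty ι]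

/-- **AM–GM in `ℝ≥0∞`**: `(a b)^{1/2} ≤ a + b`. [folklore] -/
theorem ENNReal.mul_rpow_half_le_add (a b : ℝ≥0∞) : (a * b) ^ (1 / 2 : ℝ) ≤ a + b := by
  have h : a * b ≤ (a + b) ^ (2 : ℝ) := by
    rw [show (2 : ℝ) = (2 : ℕ) by norm_num, ENNReal.rpow_natCast, sq]
    exact mul_le_mul' le_self_add le_add_self
  calc (a * b) ^ (1 / 2 : ℝ) ≤ ((a + b) ^ (2 : ℝ)) ^ (1 / 2 : ℝ) := by gcongr
    _ = a + b := by rw [← ENNReal.rpow_mul]; norm_num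

omit [Nonempty ι] in
/-- The `𝒳^{1}` weight of the slices of a jointly continuous field is measurable in time. [folklore] -/
theorem measurable_xPos {y : ℝ → EuclideanSpace ℝ ι → ι → ℂ} (hy : Continuous (uncurry y)) :
    Measurable fun r => xPos (y r) := by
  have h : Measurable (uncurry fun (r : ℝ) (ξ : EuclideanSpace ℝ ι) => ‖ξ‖ₑ * ‖y r ξ‖ₑ) := by
    change Measurable fun p : ℝ × EuclideanSpace ℝ ι => ‖p.2‖ₑ * ‖uncurry y p‖ₑ
    exact continuous_snd.enorm.measurable.mul hy.enorm.measurable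
  exact h.lintegral_prod_right

omit [Nonempty ι] in
/-- The mass of the slices of a jointly continuous field is measurable in time. [folklore] -/
theorem measurable_massL1 {y : ℝ → EuclideanSpace ℝ ι → ι → ℂ} (hy : Continuous (uncurry y)) :
    Measurable fun r => massL1 (y r) := by
  have h : Measurable (uncurry fun (r : ℝ) (ξ : EuclideanSpace ℝ ι) => ‖y r ξ‖ₑ) :=
    hy.enorm.measurable
  exact h.lintegral_prod_right

omit [Nonempty ι] in
/-- The band mass of the slices of a jointly continuous field is measurable in time. [folklore] -/
theorem measurable_setLIntegral_band {y : ℝ → EuclideanSpace ℝ ι → ι → ℂ}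
    (hy : Continuous (uncurry y)) (b : ℤ) :
    Measurable fun r => ∫⁻ ξ in band ι b, ‖y r ξ‖ₑ := by
  have h : Measurable (uncurry fun (r : ℝ) (ξ : EuclideanSpace ℝ ι) =>
      (band ι b).indicator (fun ξ => ‖y r ξ‖ₑ) ξ) := by
    change Measurable fun p : ℝ × EuclideanSpace ℝ ι =>
      (band ι b).indicator (fun ξ => ‖y p.1 ξ‖ₑ) p.2
    have e : (fun p : ℝ × EuclideanSpace ℝ ι => (band ι b).indicator (fun ξ => ‖y p.1 ξ‖ₑ) p.2) =
        (Prod.snd ⁻¹' band ι b).indicator fun p => ‖uncurry y p‖ₑ := by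
      funext p
      by_cases hp : p.2 ∈ band ι b
      · rw [indicator_of_mem hp, indicator_of_mem (show p ∈ Prod.snd ⁻¹' band ι b from hp)]; rfl
      · rw [indicator_of_notMem hp, indicator_of_notMem (show p ∉ Prod.snd ⁻¹' band ι b from hp)]
    rw [e]
    exact hy.enorm.measurable.indicator (measurable_snd (measurableSet_band b))
  have h2 : Measurable fun r => ∫⁻ ξ, (band ι b).indicator (fun ξ => ‖y r ξ‖ₑ) ξ :=
    h.lintegral_prod_right (ν := volume)
  have e : (fun r => ∫⁻ ξ, (band ι b).indicator (fun ξ => ‖y r ξ‖ₑ) ξ) =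
      fun r => ∫⁻ ξ in band ι b, ‖y r ξ‖ₑ :=
    funext fun r => lintegral_indicator (measurableSet_band b) _
  rw [← e]
  exact h2

/-- **The path product bound**: `∫₀ᵀ massL1(y r) massL1(z r) dr ≤ pathNorm T y · pathNorm T z` —
interpolation `massL1 ≤ xNeg^{1/2} xPos^{1/2}` at each time, `xNeg ≤ pathNormInf`, and
Cauchy–Schwarz in time (Lei–Lin 2011, (2.4)). [cite: LeiLin2011, (2.4)] -/
theorem lintegral_massL1_mul_massL1_le_pathNorm_mul (T : ℝ) {y z : ℝ → EuclideanSpace ℝ ι → ι → ℂ}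
    (hy : Continuous (uncurry y)) (hz : Continuous (uncurry z)) :
    ∫⁻ r in Ioc 0 T, massL1 (y r) * massL1 (z r) ≤ pathNorm T y * pathNorm T z := by
  set Ny := pathNormInf T y with hNy
  set Nz := pathNormInf T z with hNz
  -- pointwise interpolation on `(0, T]`
  have hpt : ∀ r ∈ Ioc (0 : ℝ) T, massL1 (y r) * massL1 (z r) ≤
      (Ny ^ (1 / 2 : ℝ) * Nz ^ (1 / 2 : ℝ)) * (xPos (y r) ^ (1 / 2 : ℝ) * xPos (z r) ^ (1 / 2 : ℝ)) := by
    intro r hr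
    have hr' : r ∈ Icc (0 : ℝ) T := ⟨hr.1.le, hr.2⟩
    have hy1 := massL1_le_sqrt_mul_sqrt (hy.uncurry_left r).aestronglyMeasurable
    have hz1 := massL1_le_sqrt_mul_sqrt (hz.uncurry_left r).aestronglyMeasurable
    have hy2 : xNeg (y r) ^ (1 / 2 : ℝ) ≤ Ny ^ (1 / 2 : ℝ) := by
      gcongr; exact xNeg_le_pathNormInf hr'
    have hz2 : xNeg (z r) ^ (1 / 2 : ℝ) ≤ Nz ^ (1 / 2 : ℝ) := by
      gcongr; exact xNeg_le_pathNormInf hr'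
    calc massL1 (y r) * massL1 (z r)
        ≤ (xNeg (y r) ^ (1 / 2 : ℝ) * xPos (y r) ^ (1 / 2 : ℝ)) *
            (xNeg (z r) ^ (1 / 2 : ℝ) * xPos (z r) ^ (1 / 2 : ℝ)) := mul_le_mul' hy1 hz1
      _ ≤ (Ny ^ (1 / 2 : ℝ) * xPos (y r) ^ (1 / 2 : ℝ)) * (Nz ^ (1 / 2 : ℝ) * xPos (z r) ^ (1 / 2 : ℝ)) := by
          gcongr
      _ = _ := by ring
  -- Cauchy–Schwarz in time
  have hfm : AEMeasurable (fun r => xPos (y r) ^ (1 / 2 : ℝ)) (volume.restrict (Ioc 0 T)) :=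
    ((measurable_xPos hy).pow_const _).aemeasurable
  have hgm : AEMeasurable (fun r => xPos (z r) ^ (1 / 2 : ℝ)) (volume.restrict (Ioc 0 T)) :=
    ((measurable_xPos hz).pow_const _).aemeasurable
  have hCS := ENNReal.lintegral_mul_le_Lp_mul_Lq (volume.restrict (Ioc 0 T))
    Real.HolderConjugate.two_two hfm hgm
  have e2 : ∀ x : ℝ≥0∞, (x ^ (1 / 2 : ℝ)) ^ (2 : ℝ) = x := fun x => by
    rw [← ENNReal.rpow_mul]; norm_num
  simp only [Pi.mul_apply, e2] at hCS
  calc ∫⁻ r in Ioc 0 T, massL1 (y r) * massL1 (z r)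
      ≤ ∫⁻ r in Ioc 0 T, (Ny ^ (1 / 2 : ℝ) * Nz ^ (1 / 2 : ℝ)) *
          (xPos (y r) ^ (1 / 2 : ℝ) * xPos (z r) ^ (1 / 2 : ℝ)) := setLIntegral_mono' measurableSet_Ioc hpt
    _ = (Ny ^ (1 / 2 : ℝ) * Nz ^ (1 / 2 : ℝ)) *
          ∫⁻ r in Ioc 0 T, xPos (y r) ^ (1 / 2 : ℝ) * xPos (z r) ^ (1 / 2 : ℝ) := by
        rw [lintegral_const_mul'' _
          (f := fun r => xPos (y r) ^ (1 / 2 : ℝ) * xPos (z r) ^ (1 / 2 : ℝ)) (hfm.mul hgm)]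
    _ ≤ (Ny ^ (1 / 2 : ℝ) * Nz ^ (1 / 2 : ℝ)) *
          ((∫⁻ r in Ioc 0 T, xPos (y r)) ^ (1 / 2 : ℝ) * (∫⁻ r in Ioc 0 T, xPos (z r)) ^ (1 / 2 : ℝ)) :=
        mul_le_mul' le_rfl hCS
    _ = (Ny * pathNormOne T y) ^ (1 / 2 : ℝ) * (Nz * pathNormOne T z) ^ (1 / 2 : ℝ) := by
        rw [ENNReal.mul_rpow_of_nonneg _ _ (by norm_num : (0 : ℝ) ≤ 1 / 2),
          ENNReal.mul_rpow_of_nonneg _ _ (by norm_num : (0 : ℝ) ≤ 1 / 2), pathNormOne, pathNormOne]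
        ring
    _ ≤ pathNorm T y * pathNorm T z :=
        mul_le_mul' (ENNReal.mul_rpow_half_le_add _ _) (ENNReal.mul_rpow_half_le_add _ _)

variable [DecidableEq ι]

/-- **The quadratic estimate** (Lei–Lin 2011, proof of Thm. 1.1, in Fourier variables and
Chemin–Lerner form): for `c > 0` and jointly continuous coefficient fields,
`pathNorm T (duhamelBilin c y z) ≤ 4π(card ι)² (1 + c⁻¹) · pathNorm T y · pathNorm T z`. [cite: LeiLin2011, Thm. 1.1 (proof)] -/
theorem pathNorm_duhamelBilin_le_mul {c T : ℝ} (hc : 0 < c) {y z : ℝ → EuclideanSpace ℝ ι → ι → ℂ}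
    (hy : Continuous (uncurry y)) (hz : Continuous (uncurry z)) :
    pathNorm T (duhamelBilin c y z) ≤
      nonlinMassConst ι * (1 + ENNReal.ofReal c⁻¹) * (pathNorm T y * pathNorm T z) :=
  (pathNorm_duhamelBilin_le hc hy hz).trans
    (mul_le_mul' le_rfl (lintegral_massL1_mul_massL1_le_pathNorm_mul T hy hz))

omit [DecidableEq ι] in
/-- **Band decomposition of the mass–mass integral**:
`∫₀ᵀ massL1(G r) massL1(y r) dr = ∑_b ∫₀ᵀ massL1(G r) ∫_{band b} ‖y(r)‖ dr`. [folklore] -/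
theorem lintegral_massL1_mul_massL1_eq_tsum (T : ℝ) {G y : ℝ → EuclideanSpace ℝ ι → ι → ℂ}
    (hG : Continuous (uncurry G)) (hy : Continuous (uncurry y)) :
    ∫⁻ r in Ioc 0 T, massL1 (G r) * massL1 (y r) =
      ∑' b : ℤ, ∫⁻ r in Ioc 0 T, massL1 (G r) * ∫⁻ ξ in band ι b, ‖y r ξ‖ₑ := by
  rw [← lintegral_tsum (f := fun (b : ℤ) (r : ℝ) => massL1 (G r) * ∫⁻ ξ in band ι b, ‖y r ξ‖ₑ)
    fun b => ((measurable_massL1 hG).mul (measurable_setLIntegral_band hy b)).aemeasurable]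
  refine lintegral_congr fun r => ?_
  rw [massL1_eq (y r), lintegral_eq_tsum_band, ENNReal.tsum_mul_left]

omit [DecidableEq ι] [Nonempty ι] in
/-- **Band term, low-frequency form** (input band below the coefficient's scale): with
`massL1(G r) ≤ g r` on `(0, T]`,
`∫₀ᵀ massL1(G r) ∫_{band b} ‖y(r)‖ dr ≤ 2^{b+1} (∫₀ᵀ g) · bandSup T y b` — the time integral of
the coefficient's mass (small for a coefficient living at a high, fast-decaying scale) against
the sup in time of the band's `𝒳^{-1}` weight. [folklore] -/
theorem lintegral_massL1_mul_band_le_low {T : ℝ} {G y : ℝ → EuclideanSpace ℝ ι → ι → ℂ}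
    {g : ℝ → ℝ≥0∞} (hgm : Measurable g) (hg : ∀ r ∈ Ioc 0 T, massL1 (G r) ≤ g r) (b : ℤ) :
    ∫⁻ r in Ioc 0 T, massL1 (G r) * ∫⁻ ξ in band ι b, ‖y r ξ‖ₑ ≤
      ENNReal.ofReal ((2 : ℝ) ^ (b + 1)) * (∫⁻ r in Ioc 0 T, g r) * bandSup T y b := by
  calc ∫⁻ r in Ioc 0 T, massL1 (G r) * ∫⁻ ξ in band ι b, ‖y r ξ‖ₑ
      ≤ ∫⁻ r in Ioc 0 T, g r * (ENNReal.ofReal ((2 : ℝ) ^ (b + 1)) * bandSup T y b) := by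
        refine setLIntegral_mono' measurableSet_Ioc fun r hr => mul_le_mul' (hg r hr) ?_
        exact (setLIntegral_band_enorm_le_zpow_mul (y r) b).trans
          (mul_le_mul' le_rfl (setLIntegral_band_le_bandSup ⟨hr.1.le, hr.2⟩ b))
    _ = ENNReal.ofReal ((2 : ℝ) ^ (b + 1)) * (∫⁻ r in Ioc 0 T, g r) * bandSup T y b := by
        rw [lintegral_mul_const _ hgm]
        ring

omit [DecidableEq ι] [Nonempty ι] in
/-- **Band term, high-frequency form** (input band above the coefficient's scale): with
`massL1(G r) ≤ g r ≤ gsup` on `(0, T]`,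
`∫₀ᵀ massL1(G r) ∫_{band b} ‖y(r)‖ dr ≤ 2^{-b} gsup ∫₀ᵀ ∫_{band b} ‖ξ‖ ‖y(r,ξ)‖ dξ dr` — the sup
of the coefficient's mass against the band's share of `pathNormOne`. [folklore] -/
theorem lintegral_massL1_mul_band_le_high {T : ℝ} {G y : ℝ → EuclideanSpace ℝ ι → ι → ℂ}
    {gsup : ℝ≥0∞} (hgsup : gsup ≠ ⊤) (hg : ∀ r ∈ Ioc 0 T, massL1 (G r) ≤ gsup) (b : ℤ) :
    ∫⁻ r in Ioc 0 T, massL1 (G r) * ∫⁻ ξ in band ι b, ‖y r ξ‖ₑ ≤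
      ENNReal.ofReal ((2 : ℝ) ^ (-b)) * gsup * ∫⁻ r in Ioc 0 T, ∫⁻ ξ in band ι b, ‖ξ‖ₑ * ‖y r ξ‖ₑ := by
  calc ∫⁻ r in Ioc 0 T, massL1 (G r) * ∫⁻ ξ in band ι b, ‖y r ξ‖ₑ
      ≤ ∫⁻ r in Ioc 0 T, gsup * (ENNReal.ofReal ((2 : ℝ) ^ (-b)) *
          ∫⁻ ξ in band ι b, ‖ξ‖ₑ * ‖y r ξ‖ₑ) :=
        setLIntegral_mono' measurableSet_Ioc fun r hr =>
          mul_le_mul' (hg r hr) (setLIntegral_band_enorm_le_zpow_neg_mul (y r) b)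
    _ = ENNReal.ofReal ((2 : ℝ) ^ (-b)) * gsup *
          ∫⁻ r in Ioc 0 T, ∫⁻ ξ in band ι b, ‖ξ‖ₑ * ‖y r ξ‖ₑ := by
        rw [← lintegral_const_mul' _ _ (ENNReal.mul_ne_top ENNReal.ofReal_ne_top hgsup)]
        refine lintegral_congr fun r => ?_
        ring

omit [DecidableEq ι] in
/-- **The band shares of `pathNormOne` sum to it**:
`∑_b ∫₀ᵀ ∫_{band b} ‖ξ‖ ‖y(r,ξ)‖ dξ dr = pathNormOne T y`. [folklore] -/
theorem tsum_lintegral_band_xPos_eq (T : ℝ) {y : ℝ → EuclideanSpace ℝ ι → ι → ℂ}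
    (hy : Continuous (uncurry y)) :
    ∑' b : ℤ, ∫⁻ r in Ioc 0 T, ∫⁻ ξ in band ι b, ‖ξ‖ₑ * ‖y r ξ‖ₑ = pathNormOne T y := by
  have hmeas : ∀ b : ℤ, AEMeasurable (fun r => ∫⁻ ξ in band ι b, ‖ξ‖ₑ * ‖y r ξ‖ₑ)
      (volume.restrict (Ioc 0 T)) := by
    intro b
    have h : Measurable (uncurry fun (r : ℝ) (ξ : EuclideanSpace ℝ ι) =>
        (band ι b).indicator (fun ξ => ‖ξ‖ₑ * ‖y r ξ‖ₑ) ξ) := by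
      change Measurable fun p : ℝ × EuclideanSpace ℝ ι =>
        (band ι b).indicator (fun ξ => ‖ξ‖ₑ * ‖y p.1 ξ‖ₑ) p.2
      have e : (fun p : ℝ × EuclideanSpace ℝ ι =>
          (band ι b).indicator (fun ξ => ‖ξ‖ₑ * ‖y p.1 ξ‖ₑ) p.2) =
          (Prod.snd ⁻¹' band ι b).indicator fun p => ‖p.2‖ₑ * ‖uncurry y p‖ₑ := by
        funext p
        by_cases hp : p.2 ∈ band ι b
        · rw [indicator_of_mem hp, indicator_of_mem (show p ∈ Prod.snd ⁻¹' band ι b from hp)]; rfl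
        · rw [indicator_of_notMem hp, indicator_of_notMem (show p ∉ Prod.snd ⁻¹' band ι b from hp)]
      rw [e]
      exact (continuous_snd.enorm.measurable.mul hy.enorm.measurable).indicator
        (measurable_snd (measurableSet_band b))
    have h2 : Measurable fun r => ∫⁻ ξ, (band ι b).indicator (fun ξ => ‖ξ‖ₑ * ‖y r ξ‖ₑ) ξ :=
      h.lintegral_prod_right (ν := volume)
    have e2 : (fun r => ∫⁻ ξ, (band ι b).indicator (fun ξ => ‖ξ‖ₑ * ‖y r ξ‖ₑ) ξ) =
        fun r => ∫⁻ ξ in band ι b, ‖ξ‖ₑ * ‖y r ξ‖ₑ :=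
      funext fun r => lintegral_indicator (measurableSet_band b) _
    rw [← e2]
    exact h2.aemeasurable
  rw [← lintegral_tsum (f := fun (b : ℤ) (r : ℝ) => ∫⁻ ξ in band ι b, ‖ξ‖ₑ * ‖y r ξ‖ₑ) hmeas,
    pathNormOne]
  refine lintegral_congr fun r => ?_
  rw [xPos, lintegral_eq_tsum_band]

omit [DecidableEq ι] in
/-- **The low-frequency linear bound**: if the coefficient's mass is uniformly at most `wsup` on
`(0, T]` (e.g. a field living at frequencies of unit size, with no heat decay), then
`∫₀ᵀ massL1(W r) massL1(y r) dr ≤ wsup √T · pathNorm T y` (Cauchy–Schwarz in time and the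
interpolation inequality; this is the `√T Q²` bound of Bourgain–Pavlović 2008, §3.2, for the
interaction with the inflating low mode). [folklore] -/
theorem lintegral_massL1_mul_massL1_le_sqrt {T : ℝ} (hT : 0 ≤ T)
    {W y : ℝ → EuclideanSpace ℝ ι → ι → ℂ} (hy : Continuous (uncurry y)) {wsup : ℝ≥0∞}
    (hW : ∀ r ∈ Ioc 0 T, massL1 (W r) ≤ wsup) :
    ∫⁻ r in Ioc 0 T, massL1 (W r) * massL1 (y r) ≤
      wsup * ENNReal.ofReal (Real.sqrt T) * pathNorm T y := by
  have hm : AEMeasurable (fun r => massL1 (y r)) (volume.restrict (Ioc 0 T)) :=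
    (measurable_massL1 hy).aemeasurable
  -- Cauchy–Schwarz in time against the constant `1`
  have hCS := ENNReal.lintegral_mul_le_Lp_mul_Lq (volume.restrict (Ioc 0 T))
    Real.HolderConjugate.two_two aemeasurable_const hm (f := fun _ => (1 : ℝ≥0∞))
  simp only [Pi.mul_apply, one_mul, ENNReal.one_rpow, lintegral_const, Measure.restrict_apply
    MeasurableSet.univ, univ_inter, Real.volume_Ioc, sub_zero] at hCS
  -- the square integral of the mass
  have hsq : ∫⁻ r in Ioc 0 T, massL1 (y r) ^ (2 : ℝ) ≤ pathNormInf T y * pathNormOne T y := by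
    calc ∫⁻ r in Ioc 0 T, massL1 (y r) ^ (2 : ℝ)
        ≤ ∫⁻ r in Ioc 0 T, pathNormInf T y * xPos (y r) := by
          refine setLIntegral_mono' measurableSet_Ioc fun r hr => ?_
          rw [show (2 : ℝ) = (2 : ℕ) by norm_num, ENNReal.rpow_natCast]
          exact (massL1_sq_le (hy.uncurry_left r).aestronglyMeasurable).trans
            (mul_le_mul' (xNeg_le_pathNormInf ⟨hr.1.le, hr.2⟩) le_rfl)
      _ = pathNormInf T y * pathNormOne T y := by
          rw [lintegral_const_mul'' _ (measurable_xPos hy).aemeasurable, pathNormOne]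
  calc ∫⁻ r in Ioc 0 T, massL1 (W r) * massL1 (y r)
      ≤ ∫⁻ r in Ioc 0 T, wsup * massL1 (y r) :=
        setLIntegral_mono' measurableSet_Ioc fun r hr => mul_le_mul' (hW r hr) le_rfl
    _ = wsup * ∫⁻ r in Ioc 0 T, massL1 (y r) := lintegral_const_mul'' _ hm
    _ ≤ wsup * (ENNReal.ofReal T ^ (1 / 2 : ℝ) *
          (∫⁻ r in Ioc 0 T, massL1 (y r) ^ (2 : ℝ)) ^ (1 / 2 : ℝ)) := mul_le_mul' le_rfl hCS
    _ ≤ wsup * (ENNReal.ofReal (Real.sqrt T) * (pathNormInf T y * pathNormOne T y) ^ (1 / 2 : ℝ)) := by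
        gcongr
        · rw [Real.sqrt_eq_rpow, ENNReal.ofReal_rpow_of_nonneg hT (by norm_num)]
    _ ≤ wsup * (ENNReal.ofReal (Real.sqrt T) * pathNorm T y) := by
        gcongr; exact ENNReal.mul_rpow_half_le_add _ _
    _ = wsup * ENNReal.ofReal (Real.sqrt T) * pathNorm T y := (mul_assoc _ _ _).symm

end Consequences

end Literature.Analysis.FluidPDE.FourierNS


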